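import Summits.BirchSwinnertonDyer.BirchSwinnertonDyer.Theorems.UniversalToricDescentTwinSigmaDataOfTorsion
import Summits.BirchSwinnertonDyer.BirchSwinnertonDyer.Theorems.UniversalToricDescentRoadFFRationalDescentPerLevel
import HarnessLib

/-!
# `μ(P_Σ) = 0`: the `Σ`-Euler element of `E/ℚ` over an all-split Heegner field is not divisible by `p`
# (kernel brick N2 of memo `Cruxes/TwinSplitIMCAtThreeMult/MEMBER-INCLUSION-AT3-g12.md` §2/§4)

Width seat `bsd-wall-utd-p2-w2` (g3) for the LEAD of `stmt-BirchSwinnertonDyer-20694` / ♭B_T `stmt-BirchSwinnertonDyer-27172`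
(route `UniversalToricDescent`, line `membertower`). `--supports stmt-BirchSwinnertonDyer-20694`. Nothing booked; BSD is
proved for no curve.

`P_Σ = ∏_{w ∈ Σ} P_w ∈ Λ = ℤ_p⟦T⟧` with `P_w ∈ {N_w u² − a_w u + 1, N_w u − 1, N_w u + 1, 1}`, `u = (1+T)^{c_w}`,
`c_w = κ(Frob_w) ∈ ℤ_p` (`WeierstrassCurve.sigmaEulerElement`, `IwasawaCharacter.eulerFactor`). WE PROVE: if every `c_w ≠ 0`
then `p ∤ P_Σ` (`μ(P_Σ) = 0`), and `c_w ≠ 0` on `Σ` holds for `K` imaginary quadratic, `p` odd, `κ` anticyclotomic and every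
prime of `N_E` split in `K` (Brink: degree-one places are finitely decomposed in `K_∞^ac` — tree
`ZpExtension.frobExponentAt_ne_zero_of_degree_one`).

The one non-formal point is «`(1+T)^c ≢ 1 (mod p)` for `c ≠ 0`» (usually quoted from Lucas' theorem on the digit of
`binom(c, p^v)`); here it is proved WITHOUT Lucas by Frobenius descent in the domain `𝔽_p⟦T⟧`: write `c = p^v·u` with
`u ∈ ℤ_p^×`; `(1+T)^c = ((1+T)^u)^{p^v}`, and in characteristic `p`, `x^{p^v} = 1 ⟹ (x − 1)^{p^v} = 0 ⟹ x = 1`; but the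
coefficient of `T` in `(1+T)^u` is `u ≢ 0`. Then each `P_w mod p` is `Q(1 + ε)` with `ε = ū − 1 ≠ 0`, `ε ≡ 0 mod T`, and a
two-line case analysis on constant coefficients shows `Q(1+ε) ≠ 0` for the four shapes of `Q`.

* §1 `C_p_dvd_iff_map_toZMod_eq_zero`, `eq_one_of_pow_prime_pow_eq_one`, `coeff_one_onePlusTPow`,
  `not_C_p_dvd_onePlusTPow_sub_one` (the Lucas-free lemma).
* §2 `map_toZMod_eulerFactor_ne_zero` (every Euler factor with `c ≠ 0` has `μ = 0`), `not_C_p_dvd_sigmaEulerFactor`,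
  `exists_isUnit_coeff_of_not_C_p_dvd`.
* §3 at `E/ℚ` over `K`: `forall_frobExponentAt_ne_zero_of_satisfiesHeegnerHypothesis`, `not_C_p_dvd_sigmaEulerElement`,
  `exists_isUnit_coeff_sigmaEulerElement[_of_satisfiesHeegnerHypothesis]`, and in `R₀⟦T⟧`:
  `not_C_p_dvd_map_toUnr_of_exists_isUnit_coeff`, `not_C_p_dvd_mul_map_sigmaEulerElement` (`μ(L·P_Σ) = 0 ⟸ μ(L) = 0`),
  `regular_C_p_mul_map_sigmaEulerElement` (the `t = 0` input of the per-level descent kernel p624691/p625404).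

References: [JetchevSkinnerWan2017] §5.1 (the `Σ`-Euler factors; Remark on inert places); [Skinner2016PacificMC] §2.3
(p. 180); [Brink2007] Thm. 2; [Washington1997] §13.1 (`Λ/pΛ ≅ 𝔽_p⟦T⟧`), §7.2.
-/

set_option autoImplicit false

noncomputable section

open scoped Classical

open WeierstrassCurve NumberField IsDedekindDomain Field PowerSeries
open Literature.NumberTheory.EllipticCurves Literature.NumberTheory.EllipticCurves.GreenbergSelmer
  Literature.NumberTheory.EllipticCurves.ModularForms Literature.NumberTheory.EllipticCurves.Rank1Residual
  Literature.NumberTheory.EllipticCurves.Rank1Residual.Typed Literature.NumberTheory.EllipticCurves.Castella2018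
  Literature.NumberTheory.EllipticCurves.JetchevSkinnerWan2017 Literature.NumberTheory.GaloisRepresentations
  Literature.NumberTheory.EllipticCurves.IwasawaCharacter
open Summit.BirchSwinnertonDyer.Rank1Residual.X11b.AcSelmer Summit.BirchSwinnertonDyer.Rank1Residual.X11b.Halves
  Summit.BirchSwinnertonDyer.Rank1Residual.X2
open Summit.BirchSwinnertonDyer.Rank1Residual

namespace Summit.BirchSwinnertonDyer.Rank1Residual.X11b

namespace SigmaEulerMu

variable {p : ℕ} [hp : Fact p.Prime]

/-! ### §1 `(1+T)^c ≢ 1 (mod p)` for `c ≠ 0`, by Frobenius descent in `𝔽_p⟦T⟧` -/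

/-- `p ∣ f` in `Λ = ℤ_p⟦T⟧` iff the reduction of `f` in `𝔽_p⟦T⟧` vanishes (`Λ/pΛ ≅ 𝔽_p⟦T⟧`).
[cite: Washington1997, §13.1] -/
theorem C_p_dvd_iff_map_toZMod_eq_zero (f : IwasawaAlgebra p) :
    (PowerSeries.C (p : ℤ_[p]) : IwasawaAlgebra p) ∣ f ↔ PowerSeries.map (PadicInt.toZMod (p := p)) f = 0 := by
  rw [Literature.NumberTheory.EllipticCurves.PowerSeries.C_dvd_iff_forall_dvd_coeff, PowerSeries.ext_iff]
  refine forall_congr' fun n ↦ ?_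
  rw [PowerSeries.coeff_map, map_zero, ← RingHom.mem_ker, PadicInt.ker_toZMod, PadicInt.maximalIdeal_eq_span_p,
    Ideal.mem_span_singleton]

/-- **Frobenius descent in `𝔽_p⟦T⟧`**: `x^{p^v} = 1 ⟹ x = 1` (`(x − 1)^{p^v} = x^{p^v} − 1 = 0` in characteristic `p`, and
`𝔽_p⟦T⟧` is a domain). [cite: Washington1997, §7.2] -/
theorem eq_one_of_pow_prime_pow_eq_one {x : PowerSeries (ZMod p)} {v : ℕ} (h : x ^ p ^ v = 1) : x = 1 := by
  haveI : CharP (PowerSeries (ZMod p)) p :=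
    charP_of_injective_algebraMap (algebraMap (ZMod p) (PowerSeries (ZMod p))).injective p
  have h1 : (x - 1) ^ p ^ v = 0 := by rw [sub_pow_char_pow, h, one_pow, sub_self]
  exact sub_eq_zero.mp ((pow_eq_zero_iff (pow_ne_zero v hp.out.ne_zero)).mp h1)

/-- The coefficient of `T` in `(1+T)^a` is `a` (`binom(a,1) = a`). [cite: Washington1997, §7.2] -/
theorem coeff_one_onePlusTPow (a : ℤ_[p]) :
    PowerSeries.coeff 1 (onePlusTPow p ℤ_[p] a : IwasawaAlgebra p) = a := by
  rw [val_onePlusTPow, PowerSeries.binomialSeries_coeff, Ring.choose_one_right, smul_eq_mul, mul_one]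

/-- **`(1+T)^a ≢ 1 (mod p)` for every non-zero `p`-adic exponent `a`** — WITHOUT Lucas: `a = p^v·u`, `u` a unit;
modulo `p`, `((1+T)^u)^{p^v} = (1+T)^a ≡ 1` forces `(1+T)^u ≡ 1` by Frobenius descent, but the coefficient of `T` in
`(1+T)^u` is the unit `u`. [cite: Washington1997, §7.2 and §13.1] -/
theorem not_C_p_dvd_onePlusTPow_sub_one {a : ℤ_[p]} (ha : a ≠ 0) :
    ¬ (PowerSeries.C (p : ℤ_[p]) : IwasawaAlgebra p) ∣ ((onePlusTPow p ℤ_[p] a : IwasawaAlgebra p) - 1) := by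
  intro hdvd
  have h1 : PowerSeries.map (PadicInt.toZMod (p := p)) (onePlusTPow p ℤ_[p] a : IwasawaAlgebra p) = 1 := by
    have h := (C_p_dvd_iff_map_toZMod_eq_zero _).mp hdvd
    rwa [map_sub, map_one, sub_eq_zero] at h
  have hau : a = (p ^ a.valuation : ℕ) • (PadicInt.unitCoeff ha : ℤ_[p]) := by
    rw [nsmul_eq_mul, Nat.cast_pow, mul_comm]
    exact PadicInt.unitCoeff_spec ha
  have h2 : PowerSeries.map (PadicInt.toZMod (p := p))
      (onePlusTPow p ℤ_[p] (PadicInt.unitCoeff ha : ℤ_[p]) : IwasawaAlgebra p) ^ p ^ a.valuation = 1 := by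
    rw [← map_pow, ← Units.val_pow_eq_pow_val, ← onePlusTPow_nsmul, ← hau, h1]
  have h3 := congrArg (PowerSeries.coeff 1) (eq_one_of_pow_prime_pow_eq_one h2)
  rw [PowerSeries.coeff_map, coeff_one_onePlusTPow, PowerSeries.coeff_one, if_neg one_ne_zero] at h3
  exact ((PadicInt.unitCoeff ha).isUnit.map (PadicInt.toZMod (p := p))).ne_zero h3

/-! ### §2 Every `Σ`-Euler factor with `c_w ≠ 0` has `μ = 0`; hence `μ(P_Σ) = 0` -/

/-- **`μ(P_w) = 0` when `c_w ≠ 0`.** Modulo `p`, `u = (1+T)^{c_w} = 1 + ε` with `ε ≠ 0`, `ε ≡ 0 (mod T)`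
(`not_C_p_dvd_onePlusTPow_sub_one`); then `N u − 1 = (N−1) + Nε`, `N u + 1 = (N+1) + Nε`,
`N u² − a u + 1 = (N − a + 1) + ε((2N − a) + Nε)` are non-zero in the domain `𝔽_p⟦T⟧` (read constant coefficients).
[cite: JetchevSkinnerWan2017, §5.1 (Remark: only places with `Ψ(Frob_w) = 1` can contribute to `μ`)]
[cite: Skinner2016PacificMC, §2.3 (p. 180)] -/
theorem map_toZMod_eulerFactor_ne_zero (Nw : ℕ) (t : LocalReductionData) {c : ℤ_[p]} (hc : c ≠ 0) :
    PowerSeries.map (PadicInt.toZMod (p := p)) (eulerFactor p ℤ_[p] Nw t c) ≠ 0 := by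
  set red := PowerSeries.map (PadicInt.toZMod (p := p)) with hred
  set ε : PowerSeries (ZMod p) := red (onePlusTPow p ℤ_[p] c : IwasawaAlgebra p) - 1 with hε
  have hε0 : ε ≠ 0 := by
    intro h
    apply not_C_p_dvd_onePlusTPow_sub_one hc
    rw [C_p_dvd_iff_map_toZMod_eq_zero, map_sub, map_one]
    exact h
  have hεc : PowerSeries.constantCoeff ε = 0 := by
    rw [hε, map_sub, map_one, ← PowerSeries.coeff_zero_eq_constantCoeff_apply, PowerSeries.coeff_map,
      val_onePlusTPow, PowerSeries.coeff_zero_eq_constantCoeff_apply, PowerSeries.binomialSeries_constantCoeff,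
      map_one, sub_self]
  have hu : red (onePlusTPow p ℤ_[p] c : IwasawaAlgebra p) = 1 + ε := by rw [hε]; ring
  have hN : red (Nw : IwasawaAlgebra p) = PowerSeries.C (Nw : ZMod p) := by rw [map_natCast, map_natCast]
  cases t with
  | additive =>
      rw [eulerFactor_additive, map_one]
      exact one_ne_zero
  | splitMult =>
      rw [eulerFactor_splitMult, map_sub, map_mul, map_one, hN, hu]
      intro h
      have hcc := congrArg PowerSeries.constantCoeff h
      rw [map_sub, map_mul, PowerSeries.constantCoeff_C, map_add, map_one, hεc, add_zero, mul_one,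
        map_zero, sub_eq_zero] at hcc
      apply hε0
      rw [← h, hcc, map_one]
      ring
  | nonsplitMult =>
      rw [eulerFactor_nonsplitMult, map_add, map_mul, map_one, hN, hu]
      intro h
      have hcc := congrArg PowerSeries.constantCoeff h
      rw [map_add, map_mul, PowerSeries.constantCoeff_C, map_add, map_one, hεc, add_zero, mul_one,
        map_zero, ← eq_neg_iff_add_eq_zero] at hcc
      apply hε0
      rw [← neg_eq_zero, ← h, hcc, map_neg, map_one]
      ring
  | good a =>
      have ha : red (a : IwasawaAlgebra p) = PowerSeries.C (a : ZMod p) := by rw [map_intCast, map_intCast]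
      rw [eulerFactor_good, map_add, map_sub, map_mul, map_mul, map_pow, map_one, hN, ha, hu]
      intro h
      have hG : PowerSeries.C (Nw : ZMod p) * (1 + ε) ^ 2 - PowerSeries.C (a : ZMod p) * (1 + ε) + 1 =
          (PowerSeries.C (Nw : ZMod p) - PowerSeries.C (a : ZMod p) + 1) +
            ε * ((2 * PowerSeries.C (Nw : ZMod p) - PowerSeries.C (a : ZMod p)) +
              PowerSeries.C (Nw : ZMod p) * ε) := by
        ring
      rw [hG] at h
      -- constant coefficients: `N − a + 1 = 0`
      have h0 : (Nw : ZMod p) - a + 1 = 0 := by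
        have h' := congrArg PowerSeries.constantCoeff h
        rwa [map_add, map_mul, hεc, zero_mul, add_zero, map_add, map_sub, PowerSeries.constantCoeff_C,
          PowerSeries.constantCoeff_C, map_one, map_zero] at h'
      have hconst : PowerSeries.C (Nw : ZMod p) - PowerSeries.C (a : ZMod p) + 1 = 0 := by
        rw [← map_one (PowerSeries.C (R := ZMod p)), ← map_sub, ← map_add, h0, map_zero]
      rw [hconst, zero_add] at h
      have h1 : (2 * PowerSeries.C (Nw : ZMod p) - PowerSeries.C (a : ZMod p)) + PowerSeries.C (Nw : ZMod p) * ε = 0 :=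
        (mul_eq_zero.mp h).resolve_left hε0
      -- constant coefficients again: `2N − a = 0`
      have h1c : 2 * (Nw : ZMod p) - a = 0 := by
        have h' := congrArg PowerSeries.constantCoeff h1
        rwa [map_add, map_mul, hεc, mul_zero, add_zero, map_sub, map_mul, map_ofNat, PowerSeries.constantCoeff_C,
          PowerSeries.constantCoeff_C, map_zero] at h'
      have hlin : 2 * PowerSeries.C (Nw : ZMod p) - PowerSeries.C (a : ZMod p) = 0 := by
        rw [← map_ofNat (PowerSeries.C (R := ZMod p)) 2, ← map_mul, ← map_sub, h1c, map_zero]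
      rw [hlin, zero_add] at h1
      -- `N ε = 0`, so `N = 0`, `a = 0`, contradicting `N − a + 1 = 0`
      have hN0 : PowerSeries.C (Nw : ZMod p) = 0 := (mul_eq_zero.mp h1).resolve_right hε0
      have hN0' : (Nw : ZMod p) = 0 := by
        have h' := congrArg PowerSeries.constantCoeff hN0
        rwa [PowerSeries.constantCoeff_C, map_zero] at h'
      have ha0 : (a : ZMod p) = 0 := by
        rw [hN0', mul_zero, zero_sub, neg_eq_zero] at h1c
        exact h1c
      rw [hN0', ha0, sub_zero, zero_add] at h0
      exact one_ne_zero h0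

/-- **`μ(P_Σ) = 0`**: `p ∤ ∏_{w ∈ Σ} P_w` in `Λ` as soon as every `c_w ≠ 0` (reduce modulo `p` into the domain `𝔽_p⟦T⟧`).
[cite: JetchevSkinnerWan2017, §5.1] [cite: Skinner2016PacificMC, §2.3 (p. 180)] -/
theorem not_C_p_dvd_sigmaEulerFactor {ι : Type*} (S : Finset ι) (Nw : ι → ℕ) (t : ι → LocalReductionData)
    (c : ι → ℤ_[p]) (hc : ∀ w ∈ S, c w ≠ 0) :
    ¬ (PowerSeries.C (p : ℤ_[p]) : IwasawaAlgebra p) ∣ sigmaEulerFactor p ℤ_[p] S Nw t c := by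
  rw [C_p_dvd_iff_map_toZMod_eq_zero]
  unfold sigmaEulerFactor
  rw [map_prod]
  exact Finset.prod_ne_zero_iff.mpr fun w hw ↦ map_toZMod_eulerFactor_ne_zero (Nw w) (t w) (hc w hw)

/-- In `Λ = ℤ_p⟦T⟧`: `p ∤ f` iff some coefficient of `f` is a unit (`ℤ_p` is local with maximal ideal `(p)`).
[cite: Washington1997, §13.1] -/
theorem exists_isUnit_coeff_of_not_C_p_dvd {f : IwasawaAlgebra p}
    (h : ¬ (PowerSeries.C (p : ℤ_[p]) : IwasawaAlgebra p) ∣ f) : ∃ i : ℕ, IsUnit (PowerSeries.coeff i f) := by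
  rw [Literature.NumberTheory.EllipticCurves.PowerSeries.C_dvd_iff_forall_dvd_coeff, not_forall] at h
  obtain ⟨i, hi⟩ := h
  refine ⟨i, ?_⟩
  by_contra hu
  apply hi
  have hx : PowerSeries.coeff i f ∈ IsLocalRing.maximalIdeal ℤ_[p] :=
    (IsLocalRing.mem_maximalIdeal _).mpr (mem_nonunits_iff.mpr hu)
  rwa [PadicInt.maximalIdeal_eq_span_p, Ideal.mem_span_singleton] at hx

end SigmaEulerMu

/-! ### §3 At `E/ℚ` over `K`: `μ(P_Σ(E/K)) = 0` under the all-split Heegner hypothesis -/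

section Curve

variable (W : WeierstrassCurve ℚ) (p : ℕ) [Fact p.Prime] {K : Type} [Field K] [NumberField K]

/-- **`c_w ≠ 0` at every place of `Σ(E,p)(K)`** for `K` imaginary quadratic, `p` odd, `κ` anticyclotomic and every prime of
`N_E` split in `K`: `w ∈ Σ` lies over some `ℓ ∣ N_E` (`exists_prime_mem_of_mem_sigmaPlacesFinset`), `ℓ` splits, so `w`
has degree one and is finitely decomposed in `K_∞^ac` (Brink). [cite: Brink2007, Thm. 2 (pp. 2134–2135) and Cor. 1]
[cite: GrossLMS1991, §1 (p. 235) (every prime of `N` splits in `K`)] -/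
theorem forall_frobExponentAt_ne_zero_of_satisfiesHeegnerHypothesis [W.IsElliptic] (hp2 : p ≠ 2)
    (hK : IsImaginaryQuadratic K)
    (hH : SatisfiesHeegnerHypothesis (W.conductorNorm ℤ) K) (κ : ZpExtension K p) (hκ : κ.IsAnticyclotomic) :
    ∀ w ∈ W.sigmaPlacesFinset p K, κ.frobExponentAt w ≠ 0 := by
  intro w hw
  obtain ⟨ℓ, hℓ, hℓN, -, hℓw⟩ := exists_prime_mem_of_mem_sigmaPlacesFinset W p hw
  haveI : Fact ℓ.Prime := ⟨hℓ⟩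
  obtain ⟨he, hf⟩ := degreeOne_of_splitsIn hK.1 (hH ℓ hℓ hℓN) hℓw
  exact κ.frobExponentAt_ne_zero_of_degree_one hK hp2 hκ (W.forall_mem_sigmaPlacesFinset_not_mem p K w hw) he hf

/-- **`μ(P_Σ(E/K)) = 0`**: `p ∤ P_Σ(E/K)` in `Λ` as soon as `c_w ≠ 0` on `Σ`. [cite: JetchevSkinnerWan2017, §5.1]
[cite: Skinner2016PacificMC, §2.3 (p. 180)] -/
theorem not_C_p_dvd_sigmaEulerElement (κ : ZpExtension K p)
    (hc : ∀ w ∈ W.sigmaPlacesFinset p K, κ.frobExponentAt w ≠ 0) :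
    ¬ (PowerSeries.C (p : ℤ_[p]) : IwasawaAlgebra p) ∣ W.sigmaEulerElement p K κ := by
  rw [WeierstrassCurve.sigmaEulerElement_def]
  exact SigmaEulerMu.not_C_p_dvd_sigmaEulerFactor _ _ _ _ hc

/-- `μ(P_Σ(E/K)) = 0` as a unit coefficient, given `c_w ≠ 0` on `Σ`. [cite: JetchevSkinnerWan2017, §5.1] -/
theorem exists_isUnit_coeff_sigmaEulerElement (κ : ZpExtension K p)
    (hc : ∀ w ∈ W.sigmaPlacesFinset p K, κ.frobExponentAt w ≠ 0) :
    ∃ i : ℕ, IsUnit (PowerSeries.coeff i (W.sigmaEulerElement p K κ)) :=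
  SigmaEulerMu.exists_isUnit_coeff_of_not_C_p_dvd (not_C_p_dvd_sigmaEulerElement W p κ hc)

/-- **`μ(P_Σ(E/K)) = 0` UNDER THE ALL-SPLIT HEEGNER HYPOTHESIS** (`K` imaginary quadratic, `p` odd, `κ` anticyclotomic, every
prime of `N_E` split in `K`): some coefficient of `P_Σ(E/K) ∈ Λ` is a unit. Unconditional. [cite: JetchevSkinnerWan2017, §5.1]
[cite: Brink2007, Thm. 2] -/
theorem exists_isUnit_coeff_sigmaEulerElement_of_satisfiesHeegnerHypothesis [W.IsElliptic] (hp2 : p ≠ 2)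
    (hK : IsImaginaryQuadratic K) (hH : SatisfiesHeegnerHypothesis (W.conductorNorm ℤ) K) (κ : ZpExtension K p)
    (hκ : κ.IsAnticyclotomic) : ∃ i : ℕ, IsUnit (PowerSeries.coeff i (W.sigmaEulerElement p K κ)) :=
  exists_isUnit_coeff_sigmaEulerElement W p κ
    (forall_frobExponentAt_ne_zero_of_satisfiesHeegnerHypothesis W p hp2 hK hH κ hκ)

/-- Transfer to `R₀⟦T⟧`: a series over `ℤ_p` with a unit coefficient stays prime to `p` after `map toUnr`.
[cite: Castella2018, §3 (p. 9)] -/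
theorem not_C_p_dvd_map_toUnr_of_exists_isUnit_coeff {f : IwasawaAlgebra p}
    (h : ∃ i : ℕ, IsUnit (PowerSeries.coeff i f)) :
    ¬ (C ((p : ℕ) : unrIntegers p) : UnrSeries p) ∣ PowerSeries.map (toUnr p) f := by
  rintro ⟨g, hg⟩
  obtain ⟨i, hi⟩ := h
  have h1 : PowerSeries.coeff i (PowerSeries.map (toUnr p) f) = ((p : ℕ) : unrIntegers p) * PowerSeries.coeff i g := by
    rw [hg, PowerSeries.coeff_C_mul]
  rw [PowerSeries.coeff_map] at h1
  have h2 : IsUnit (((p : ℕ) : unrIntegers p) * PowerSeries.coeff i g) := h1 ▸ hi.map (toUnr p)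
  exact (HidaLimitAlgebra.irreducible_natCast_p (p := p)).not_isUnit (isUnit_of_mul_isUnit_left h2)

/-- **`μ(L·P_Σ) = 0 ⟸ μ(L) = 0`** in `R₀⟦T⟧` (given `c_w ≠ 0` on `Σ`): `C(p)` is prime in `R₀⟦T⟧` and divides neither factor.
[cite: Castella2018, §3 (p. 9)] [cite: JetchevSkinnerWan2017, §5.1] -/
theorem not_C_p_dvd_mul_map_sigmaEulerElement (κ : ZpExtension K p)
    (hc : ∀ w ∈ W.sigmaPlacesFinset p K, κ.frobExponentAt w ≠ 0) {L : UnrSeries p}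
    (hL : ¬ (C ((p : ℕ) : unrIntegers p) : UnrSeries p) ∣ L) :
    ¬ (C ((p : ℕ) : unrIntegers p) : UnrSeries p) ∣ L * PowerSeries.map (toUnr p) (W.sigmaEulerElement p K κ) := by
  have hprime : Prime (C ((p : ℕ) : unrIntegers p) : UnrSeries p) :=
    prime_C_of_prime CongruenceDescent.prime_natCast_p_unrIntegers
  intro h
  rcases hprime.dvd_or_dvd h with h1 | h1
  · exact hL h1
  · exact not_C_p_dvd_map_toUnr_of_exists_isUnit_coeff p (exists_isUnit_coeff_sigmaEulerElement W p κ hc) h1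

/-- **The `t = 0` input of the per-level descent kernel** (p624691/p625404): for `μ(L) = 0` and `c_w ≠ 0` on `Σ`, `C(p)` is
regular modulo `L·P_Σ` in `R₀⟦T⟧`. [cite: Castella2018, §3 (p. 9)] [cite: JetchevSkinnerWan2017, §5.1] -/
theorem regular_C_p_mul_map_sigmaEulerElement (κ : ZpExtension K p)
    (hc : ∀ w ∈ W.sigmaPlacesFinset p K, κ.frobExponentAt w ≠ 0) {L : UnrSeries p}
    (hL : ¬ (C ((p : ℕ) : unrIntegers p) : UnrSeries p) ∣ L) :
    ∀ y : UnrSeries p, (C ((p : ℕ) : unrIntegers p) : UnrSeries p) * y ∈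
        Ideal.span {L * PowerSeries.map (toUnr p) (W.sigmaEulerElement p K κ)} →
      y ∈ Ideal.span {L * PowerSeries.map (toUnr p) (W.sigmaEulerElement p K κ)} :=
  CongruenceDescent.regular_of_prime_of_not_dvd (prime_C_of_prime CongruenceDescent.prime_natCast_p_unrIntegers)
    (not_C_p_dvd_mul_map_sigmaEulerElement W p κ hc hL)

end Curve

end Summit.BirchSwinnertonDyer.Rank1Residual.X11b

end
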